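import Literature.AlgebraicGeometry.Resolution.BlowupSNC
import Mathlib.Algebra.Field.ZMod
import Summits.ResolutionOfSingularities.ResolutionOfSingularities.Theorems.RadicialJungCleanModelsSufficeRoundOverCount

/-!
# Route `RadicialJung`, crux `CleanModelsSuffice`, line `Sketch`: one round over the centre — the measures upstairs

Helper for the registered stub `stub_gameRoundOver` of the skeleton of
`Summit.ResolutionOfSingularities.ResolutionOfSingularities.Theses.RadicialJung.CleanModelsSuffice`
(stmt-ResolutionOfSingularities-15883): the MEASURES after one round over the centre. For pointwise data `P` at a
point `x` of the blow-up over `v ∈ Z` whose coordinates, exponents and labels are those of the chart computation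
(`roundOver_exists_lab`; the exceptional position carries `Σ_centre a` or `0`, the other positions the old
exponents):

* `roundOver_Nval_arith` — the resonance arithmetic of a phase-2 blow-up (`N(a₀ + e) + 1 = N(e)`);
* `roundOver_phase2` — over a phase-2 centre `{old, D₀}` with `mOld x = 1`: the strict transform of `D₀` misses
  `x`, the other old divisors keep charge and resonance, the new exceptional divisor has resonance one less;
* `roundOver_measures` — `mOld x ≤ mOld v`, `<` over a phase-1 centre, and the phase-2 clause.
-/

noncomputable section

set_option linter.dupNamespace false -- mandated namespace of this single-conjunct summit

open CategoryTheory AlgebraicGeometry TopologicalSpace IsLocalRing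
open Literature.AlgebraicGeometry.Resolution Literature.AlgebraicGeometry.Motives

namespace Summit.ResolutionOfSingularities.ResolutionOfSingularities.Theorems.RadicialJung.CleanModelsSuffice

/-- **The resonance arithmetic of a phase-2 blow-up**: with `a₀` the old exponent and `e` the exponent of the
charged exceptional divisor (both prime to `p`, `p ∤ a₀ + e`), the resonance of the new exceptional divisor
(exponent `a₀ + e`) is one less than that of the old one. [folklore] -/
theorem roundOver_Nval_arith {p : ℕ} (hp : p.Prime) (a₀ e : ℕ) (ha₀ : ¬ p ∣ a₀) (he : ¬ p ∣ e)
    (hs : ¬ p ∣ a₀ + e) :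
    sInf {n : ℕ | 1 ≤ n ∧ (p ∣ (a₀ + e) + n * a₀ ∨ n = p)} + 1 =
      sInf {n : ℕ | 1 ≤ n ∧ (p ∣ e + n * a₀ ∨ n = p)} := by
  classical
  haveI := Fact.mk hp
  set A : Set ℕ := {n : ℕ | 1 ≤ n ∧ (p ∣ e + n * a₀ ∨ n = p)} with hA
  set B : Set ℕ := {n : ℕ | 1 ≤ n ∧ (p ∣ (a₀ + e) + n * a₀ ∨ n = p)} with hB
  -- a solution `n₁ ∈ [1, p-1]` of `e + n₁ a₀ ≡ 0 (mod p)`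
  have ha₀' : ((a₀ : ℕ) : ZMod p) ≠ 0 := by
    rwa [Ne, ZMod.natCast_eq_zero_iff]
  have he' : ((e : ℕ) : ZMod p) ≠ 0 := by
    rwa [Ne, ZMod.natCast_eq_zero_iff]
  set n₁ : ℕ := (-(e : ZMod p) * (a₀ : ZMod p)⁻¹).val with hn₁
  have hn₁lt : n₁ < p := ZMod.val_lt _
  have hn₁dvd : p ∣ e + n₁ * a₀ := by
    rw [← ZMod.natCast_eq_zero_iff]
    push_cast
    rw [hn₁, ZMod.natCast_zmod_val, mul_assoc, inv_mul_cancel₀ ha₀', mul_one, add_neg_cancel]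
  have hn₁pos : 1 ≤ n₁ := by
    rw [Nat.one_le_iff_ne_zero, hn₁, Ne, ZMod.val_eq_zero, mul_eq_zero, not_or]
    exact ⟨neg_ne_zero.mpr he', inv_ne_zero ha₀'⟩
  have hn₁A : n₁ ∈ A := ⟨hn₁pos, Or.inl hn₁dvd⟩
  have hAne : A.Nonempty := ⟨n₁, hn₁A⟩
  obtain ⟨hN1, hN⟩ : sInf A ∈ A := Nat.sInf_mem hAne
  have hNle : sInf A ≤ n₁ := Nat.sInf_le hn₁A
  have hNp : sInf A ≠ p := fun h => by rw [h] at hNle; exact absurd hNle (not_le.mpr hn₁lt)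
  have hNdvd : p ∣ e + sInf A * a₀ := hN.resolve_right hNp
  have hN2 : 2 ≤ sInf A := by
    by_contra h
    have h1 : sInf A = 1 := le_antisymm (Nat.lt_succ_iff.mp (not_le.mp h)) hN1
    rw [h1, one_mul, add_comm] at hNdvd
    exact hs hNdvd
  -- `N - 1 ∈ B`
  have hB1 : sInf A - 1 ∈ B := by
    refine ⟨by omega, Or.inl ?_⟩
    have : (a₀ + e) + (sInf A - 1) * a₀ = e + sInf A * a₀ := by
      obtain ⟨c, hc⟩ := Nat.exists_eq_add_of_le hN1
      rw [hc, Nat.add_sub_cancel_left]; ring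
    rw [this]; exact hNdvd
  have hBne : B.Nonempty := ⟨_, hB1⟩
  obtain ⟨hM1, hM⟩ : sInf B ∈ B := Nat.sInf_mem hBne
  have hMle : sInf B ≤ sInf A - 1 := Nat.sInf_le hB1
  have hMp : sInf B ≠ p := fun h => by
    rw [h] at hMle; omega
  have hMdvd : p ∣ (a₀ + e) + sInf B * a₀ := hM.resolve_right hMp
  have hA1 : sInf B + 1 ∈ A := by
    refine ⟨by omega, Or.inl ?_⟩
    have : e + (sInf B + 1) * a₀ = (a₀ + e) + sInf B * a₀ := by ring
    rw [this]; exact hMdvd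
  have := Nat.sInf_le hA1
  omega

variable {p : ℕ} {V₀ : Scheme.{0}} [IsIntegral V₀] {L : Type} [Field L] [Algebra V₀.functionField L]
  {V : Scheme.{0}} [IsIntegral V] {π : V ⟶ V₀} [IsDominant π]
  {V' : Scheme.{0}} {φ : V' ⟶ V} {C : V.IdealSheafData}

/-- **Phase 2 of `roundOver_measures`.** [folklore] -/
theorem roundOver_phase2 (hp : p.Prime) (S : GameState p V₀ L V π) {x : V'}
    (Dc : ChartData φ C x) (I₀ : Finset (Fin (S.d (φ x))))
    (σ : Fin Dc.r → Fin (S.d (φ x))) (σ' : Fin Dc.a → Fin (S.d (φ x)))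
    (hσ : Function.Injective σ) (hrσ : Set.range σ = (I₀ : Set _))
    (hrσσ' : ∀ t, t ∈ Set.range σ ∨ t ∈ Set.range σ') (hdisj : ∀ l m, σ l ≠ σ' m)
    [IsIntegral V'] [IsDominant (φ ≫ π)]
    (P : GameState.PointData p V₀ L V' (φ ≫ π) (S.E.map (strictTransformIdeal φ C) ++ [C.comap φ]) x)
    (lab' : Option (Fin Dc.a ⊕ Dc.GoodGen) → Fin P.d)
    (aOf : Option (Fin Dc.a ⊕ Dc.GoodGen) → ℕ)
    (haOf0 : aOf none = if p ∣ ∑ l, S.a (φ x) (σ l) then 0 else ∑ l, S.a (φ x) (σ l))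
    (haOfl : ∀ m, aOf (some (Sum.inl m)) = S.a (φ x) (σ' m))
    (haOfr : ∀ g, aOf (some (Sum.inr g)) = S.a (φ x) (σ g.1))
    (hPa : ∀ o, P.a (lab' o) = aOf o)
    (hxE : x ∈ (C.comap φ).support)
    (hmemE : C.comap φ ∈ S.E.map (strictTransformIdeal φ C) ++ [C.comap φ])
    (hmemT : ∀ K ∈ S.E, strictTransformIdeal φ C K ∈ S.E.map (strictTransformIdeal φ C) ++ [C.comap φ])
    (hlabE : ∀ D', D'.1 = C.comap φ → P.lab D' = lab' none)
    (hlabW : ∀ D' (K : {K : V.IdealSheafData // K ∈ S.E ∧ φ x ∈ K.support}) (m : Fin Dc.a),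
      strictTransformIdeal φ C K.1 = D'.1 → S.lab (φ x) K = σ' m → P.lab D' = lab' (some (Sum.inl m)))
    (hsuppW : ∀ (K : {K : V.IdealSheafData // K ∈ S.E ∧ φ x ∈ K.support}) (m : Fin Dc.a),
      S.lab (φ x) K = σ' m → x ∈ (strictTransformIdeal φ C K.1).support)
    (hsuppX : ∀ (K : {K : V.IdealSheafData // K ∈ S.E ∧ φ x ∈ K.support}) (j : Fin Dc.r),
      S.lab (φ x) K = σ j → (x ∈ (strictTransformIdeal φ C K.1).support ↔ j ≠ Dc.i ∧ Dc.gen j ∈ Dc.Q))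
    (hPold : ∀ i', i' ∈ P.oldCh ↔ (∃ m, σ' m ∈ S.oldCh (φ x) ∧ lab' (some (Sum.inl m)) = i') ∨
      (∃ g : Dc.GoodGen, σ g.1 ∈ S.oldCh (φ x) ∧ lab' (some (Sum.inr g)) = i'))
    (D₀ : {D : V.IdealSheafData // D ∈ S.E ∧ φ x ∈ D.support})
    (hm1 : S.mOld (φ x) = 1) (hch : S.chargedAt D₀.1 (φ x))
    (hI : I₀ = S.oldCh (φ x) ∪ {S.lab (φ x) D₀}) (hPm1 : P.mOld = 1) :
    ¬ P.chargedAt (strictTransformIdeal φ C D₀.1) ∧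
      (∀ D ∈ S.E, D ≠ D₀.1 →
        (P.chargedAt (strictTransformIdeal φ C D) ↔ S.chargedAt D (φ x)) ∧
        (S.chargedAt D (φ x) → P.Nval (strictTransformIdeal φ C D) = S.Nval (φ x) D)) ∧
      (P.chargedAt (C.comap φ) → P.Nval (C.comap φ) + 1 = S.Nval (φ x) D₀.1) := by
  classical
  obtain ⟨t₀, ht₀⟩ : ∃ t₀, S.oldCh (φ x) = {t₀} := Finset.card_eq_one.mp hm1
  set t₁ := S.lab (φ x) D₀ with ht₁
  have hmemS : ∀ t, t ∈ S.oldCh (φ x) ↔ S.a (φ x) t ≠ 0 ∧ ¬ S.IsLab (φ x) t := fun t => by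
    simp [GameState.oldCh, GameState.ch]
  have ht₁lab : S.IsLab (φ x) t₁ := ⟨D₀, rfl⟩
  have ht₀₁ : t₀ ≠ t₁ := fun h => by
    have : t₀ ∈ S.oldCh (φ x) := by rw [ht₀]; exact Finset.mem_singleton_self _
    exact ((hmemS t₀).mp this).2 (h ▸ ht₁lab)
  have hexpS : ∀ (K : {K : V.IdealSheafData // K ∈ S.E ∧ φ x ∈ K.support}),
      S.expOf K.1 (φ x) = S.a (φ x) (S.lab (φ x) K) := fun K => by
    simp only [GameState.expOf, dif_pos K.2]
  have he0 : S.a (φ x) t₁ ≠ 0 := by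
    have := hch; rwa [GameState.chargedAt, hexpS D₀] at this
  have hrange : ∀ t, t ∈ Set.range σ ↔ t = t₀ ∨ t = t₁ := fun t => by
    rw [hrσ, hI, ht₀]; simp
  -- the good position over `t₀`
  obtain ⟨i₀, hi₀⟩ : ∃ i₀, P.oldCh = {i₀} := Finset.card_eq_one.mp hPm1
  obtain ⟨g₀, hg₀, hg₀i⟩ : ∃ g : Dc.GoodGen, σ g.1 ∈ S.oldCh (φ x) ∧ lab' (some (Sum.inr g)) = i₀ := by
    have hi : i₀ ∈ P.oldCh := by rw [hi₀]; exact Finset.mem_singleton_self _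
    rcases (hPold i₀).mp hi with ⟨m, hm, -⟩ | h
    · exfalso
      rw [ht₀, Finset.mem_singleton] at hm
      obtain ⟨l, hl⟩ := (hrange t₀).mpr (Or.inl rfl)
      exact hdisj l m (hl.trans hm.symm)
    · exact h
  have hg₀mem : σ g₀.1 = t₀ := by
    rw [ht₀, Finset.mem_singleton] at hg₀; exact hg₀
  have hσi : σ Dc.i = t₁ := by
    rcases (hrange (σ Dc.i)).mp ⟨Dc.i, rfl⟩ with h | h
    · exact absurd (hσ (h.trans hg₀mem.symm)) (Ne.symm g₀.2.1)
    · exact h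
  have hPoldCh : P.oldCh = {lab' (some (Sum.inr g₀))} := by
    rw [hi₀, hg₀i]
  have hPoldExp : P.oldExp = S.a (φ x) t₀ := by
    simp only [GameState.PointData.oldExp, hPoldCh, Finset.sup_singleton, hPa, haOfr, hg₀mem]
  have hSoldExp : S.oldExp (φ x) = S.a (φ x) t₀ := by
    simp only [GameState.oldExp, ht₀, Finset.sup_singleton]
  have ha₀ : S.a (φ x) t₀ ≠ 0 ∧ ¬ S.IsLab (φ x) t₀ :=
    (hmemS t₀).mp (by rw [ht₀]; exact Finset.mem_singleton_self _)
  -- exponents upstairs of the strict transforms and of the exceptional divisor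
  have hexpP : ∀ (D' : V'.IdealSheafData) (h : D' ∈ S.E.map (strictTransformIdeal φ C) ++ [C.comap φ] ∧
      x ∈ D'.support), P.expOf D' = P.a (P.lab ⟨D', h⟩) := fun D' h => by
    simp only [GameState.PointData.expOf, dif_pos h]
  have hexpP0 : ∀ (D' : V'.IdealSheafData), x ∉ D'.support → P.expOf D' = 0 := fun D' h => by
    simp only [GameState.PointData.expOf]
    rw [dif_neg (fun h' => h h'.2)]
  refine ⟨fun hchT => ?_, fun D hD hne => ?_, fun hchE => ?_⟩
  · -- the strict transform of `D₀` misses `x`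
    have hxD₀ : x ∉ (strictTransformIdeal φ C D₀.1).support := fun h =>
      ((hsuppX D₀ Dc.i hσi.symm).mp h).1 rfl
    exact hchT (hexpP0 _ hxD₀)
  · by_cases hvD : φ x ∈ D.support
    · -- an old divisor through `v` other than `D₀`: its coordinate is a non-centre one
      set K : {K : V.IdealSheafData // K ∈ S.E ∧ φ x ∈ K.support} := ⟨D, hD, hvD⟩ with hK
      have hKlab : S.lab (φ x) K ∉ Set.range σ := by
        intro h
        rcases (hrange _).mp h with h0 | h1
        · exact ha₀.2 (h0 ▸ ⟨K, rfl⟩)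
        · exact hne (congrArg Subtype.val (S.lab_injective (φ x) h1))
      obtain ⟨m, hm⟩ : S.lab (φ x) K ∈ Set.range σ' := (hrσσ' _).resolve_left hKlab
      have hxT : x ∈ (strictTransformIdeal φ C D).support := hsuppW K m hm.symm
      have hexpT : P.expOf (strictTransformIdeal φ C D) = S.expOf D (φ x) := by
        rw [hexpP _ ⟨hmemT D hD, hxT⟩, hlabW ⟨_, hmemT D hD, hxT⟩ K m rfl hm.symm, hPa, haOfl, hm]
        exact (hexpS K).symm
      refine ⟨by simp only [GameState.PointData.chargedAt, GameState.chargedAt, hexpT], fun _ => ?_⟩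
      simp only [GameState.PointData.Nval, GameState.Nval, hexpT, hPoldExp, hSoldExp]
    · -- an old divisor not through `v`: absent on both sides
      have hxT : x ∉ (strictTransformIdeal φ C D).support := fun h =>
        hvD (mem_support_of_mem_support_strictTransformIdeal h)
      have h1 : ¬ P.chargedAt (strictTransformIdeal φ C D) := fun h => h (hexpP0 _ hxT)
      have h2 : ¬ S.chargedAt D (φ x) := fun h => by
        apply h
        simp only [GameState.expOf]
        rw [dif_neg (fun h' => hvD h'.2)]
      exact ⟨iff_of_false h1 h2, fun h => absurd h h2⟩
  · -- the exceptional divisor: exponent `a₀ + e`, resonance one less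
    have hsum : ∑ l, S.a (φ x) (σ l) = S.a (φ x) t₀ + S.a (φ x) t₁ := by
      have himg : Finset.univ.image σ = ({t₀, t₁} : Finset _) := by
        ext t
        simp only [Finset.mem_image, Finset.mem_univ, true_and, Finset.mem_insert, Finset.mem_singleton]
        exact (hrange t)
      rw [← Finset.sum_image (f := fun t => S.a (φ x) t) (fun l _ l' _ h => hσ h), himg,
        Finset.sum_pair ht₀₁]
    have hexpE : P.expOf (C.comap φ) = aOf none := by
      rw [hexpP _ ⟨hmemE, hxE⟩, hlabE _ rfl, hPa]
    have hndvd : ¬ p ∣ S.a (φ x) t₀ + S.a (φ x) t₁ := by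
      intro h
      apply hchE
      rw [hexpE, haOf0, hsum, if_pos h]
    have hexpE' : P.expOf (C.comap φ) = S.a (φ x) t₀ + S.a (φ x) t₁ := by
      rw [hexpE, haOf0, hsum, if_neg hndvd]
    have hpa₀ : ¬ p ∣ S.a (φ x) t₀ := (S.a_spec (φ x) t₀).resolve_left ha₀.1
    have hpe : ¬ p ∣ S.a (φ x) t₁ := (S.a_spec (φ x) t₁).resolve_left he0
    simp only [GameState.PointData.Nval, GameState.Nval, hexpE', hPoldExp, hSoldExp, hexpS D₀, ← ht₁]
    exact roundOver_Nval_arith hp _ _ hpa₀ hpe hndvd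



set_option maxHeartbeats 400000 in
/-- **The measures after one round over the centre.** For pointwise data `P` at `x` over `v = φ x ∈ Z` whose
coordinates / exponents / labels are those of the chart computation (`roundOver_exists_lab`, exponents
`aOf`: the exceptional position carries `Σ_centre a` or `0`, the other positions the old exponents), the
number of old charged components does not go up, drops in phase 1, and in phase 2 the charges and resonances
transform as in the round contract. [folklore] -/
theorem roundOver_measures (hp : p.Prime) (S : GameState p V₀ L V π) {x : V'}
    (Dc : ChartData φ C x) (I₀ : Finset (Fin (S.d (φ x))))
    (σ : Fin Dc.r → Fin (S.d (φ x))) (σ' : Fin Dc.a → Fin (S.d (φ x)))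
    (hσ : Function.Injective σ) (hσ' : Function.Injective σ') (hrσ : Set.range σ = (I₀ : Set _))
    (hrσσ' : ∀ t, t ∈ Set.range σ ∨ t ∈ Set.range σ') (hdisj : ∀ l m, σ l ≠ σ' m)
    [IsIntegral V'] [IsDominant (φ ≫ π)]
    (P : GameState.PointData p V₀ L V' (φ ≫ π) (S.E.map (strictTransformIdeal φ C) ++ [C.comap φ]) x)
    (lab' : Option (Fin Dc.a ⊕ Dc.GoodGen) → Fin P.d) (hlab' : Function.Injective lab')
    (aOf : Option (Fin Dc.a ⊕ Dc.GoodGen) → ℕ)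
    (haOf0 : aOf none = if p ∣ ∑ l, S.a (φ x) (σ l) then 0 else ∑ l, S.a (φ x) (σ l))
    (haOfl : ∀ m, aOf (some (Sum.inl m)) = S.a (φ x) (σ' m))
    (haOfr : ∀ g, aOf (some (Sum.inr g)) = S.a (φ x) (σ g.1))
    (hPa : ∀ o, P.a (lab' o) = aOf o) (hPa0 : ∀ i', (¬ ∃ o, lab' o = i') → P.a i' = 0)
    (hxE : x ∈ (C.comap φ).support)
    (hlabE : ∀ D', D'.1 = C.comap φ → P.lab D' = lab' none)
    (hlabW : ∀ D' (K : {K : V.IdealSheafData // K ∈ S.E ∧ φ x ∈ K.support}) (m : Fin Dc.a),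
      strictTransformIdeal φ C K.1 = D'.1 → S.lab (φ x) K = σ' m → P.lab D' = lab' (some (Sum.inl m)))
    (hlabX : ∀ D' (K : {K : V.IdealSheafData // K ∈ S.E ∧ φ x ∈ K.support}) (j : Fin Dc.r),
      strictTransformIdeal φ C K.1 = D'.1 → S.lab (φ x) K = σ j →
        ∃ hj : j ≠ Dc.i ∧ Dc.gen j ∈ Dc.Q, P.lab D' = lab' (some (Sum.inr ⟨j, hj⟩)))
    (hsuppW : ∀ (K : {K : V.IdealSheafData // K ∈ S.E ∧ φ x ∈ K.support}) (m : Fin Dc.a),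
      S.lab (φ x) K = σ' m → x ∈ (strictTransformIdeal φ C K.1).support)
    (hsuppX : ∀ (K : {K : V.IdealSheafData // K ∈ S.E ∧ φ x ∈ K.support}) (j : Fin Dc.r),
      S.lab (φ x) K = σ j → (x ∈ (strictTransformIdeal φ C K.1).support ↔ j ≠ Dc.i ∧ Dc.gen j ∈ Dc.Q)) :
    P.mOld ≤ S.mOld (φ x) ∧
      (I₀ = S.oldCh (φ x) → P.mOld < S.mOld (φ x)) ∧
      (∀ D₀ : {D : V.IdealSheafData // D ∈ S.E ∧ φ x ∈ D.support},
        S.mOld (φ x) = 1 → S.chargedAt D₀.1 (φ x) →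
        I₀ = S.oldCh (φ x) ∪ {S.lab (φ x) D₀} → P.mOld = 1 →
          ¬ P.chargedAt (strictTransformIdeal φ C D₀.1) ∧
          (∀ D ∈ S.E, D ≠ D₀.1 →
            (P.chargedAt (strictTransformIdeal φ C D) ↔ S.chargedAt D (φ x)) ∧
            (S.chargedAt D (φ x) → P.Nval (strictTransformIdeal φ C D) = S.Nval (φ x) D)) ∧
          (P.chargedAt (C.comap φ) → P.Nval (C.comap φ) + 1 = S.Nval (φ x) D₀.1)) := by
  classical
  -- membership of the new boundary
  have hmemE : C.comap φ ∈ S.E.map (strictTransformIdeal φ C) ++ [C.comap φ] :=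
    List.mem_append.mpr (Or.inr (List.mem_singleton.mpr rfl))
  have hmemT : ∀ K ∈ S.E, strictTransformIdeal φ C K ∈ S.E.map (strictTransformIdeal φ C) ++ [C.comap φ] :=
    fun K hK => List.mem_append.mpr (Or.inl (List.mem_map.mpr ⟨K, hK, rfl⟩))
  -- which labelled positions are boundary positions
  have hPlab : ∀ o, lab' o ∈ Set.range P.lab ↔ (o = none ∨ (∃ m, o = some (Sum.inl m) ∧ S.IsLab (φ x) (σ' m)) ∨
      (∃ g : Dc.GoodGen, o = some (Sum.inr g) ∧ S.IsLab (φ x) (σ g.1))) := by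
    intro o
    constructor
    · rintro ⟨D', hD'⟩
      by_cases hE : D'.1 = C.comap φ
      · left; exact hlab' (hD'.symm.trans (hlabE D' hE)) |>.symm ▸ rfl
      · obtain ⟨K, hK⟩ := exists_preimage_divisor D' hE
        right
        rcases hrσσ' (S.lab (φ x) K) with ⟨j, hj⟩ | ⟨m, hm⟩
        · obtain ⟨hgood, hlabD⟩ := hlabX D' K j hK hj.symm
          right
          refine ⟨⟨j, hgood⟩, hlab' (hD'.symm.trans hlabD) |>.symm ▸ rfl, ⟨K, hj.symm⟩⟩
        · left
          refine ⟨m, hlab' (hD'.symm.trans (hlabW D' K m hK hm.symm)) |>.symm ▸ rfl, ⟨K, hm.symm⟩⟩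
    · rintro (rfl | ⟨m, rfl, ⟨K, hK⟩⟩ | ⟨g, rfl, ⟨K, hK⟩⟩)
      · exact ⟨⟨C.comap φ, hmemE, hxE⟩, hlabE _ rfl⟩
      · exact ⟨⟨strictTransformIdeal φ C K.1, hmemT _ K.2.1, hsuppW K m hK⟩, hlabW _ K m rfl hK⟩
      · have hxK : x ∈ (strictTransformIdeal φ C K.1).support := (hsuppX K g.1 hK).mpr g.2
        obtain ⟨hj, h⟩ := hlabX ⟨strictTransformIdeal φ C K.1, hmemT _ K.2.1, hxK⟩ K g.1 rfl hK
        exact ⟨_, h⟩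
  -- the two counts
  have hPm := roundOver_mOld_eq S (φ x) P (fun g : Dc.GoodGen => g.1) σ σ' lab' hlab' aOf haOfl haOfr hPa
    hPa0 hPlab
  have hSm := roundOver_mOld_eq_base S (φ x) σ σ' hσ hσ' hrσσ' hdisj
  -- comparison of the good positions with the centre positions
  have hle : (Finset.univ.filter fun g : Dc.GoodGen => σ g.1 ∈ S.oldCh (φ x)).card ≤
      (Finset.univ.filter fun l => σ l ∈ S.oldCh (φ x)).card := by
    refine Finset.card_le_card_of_injOn (fun g => g.1) (fun g hg => ?_) (Set.injOn_of_injective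
      Subtype.val_injective)
    simp only [Finset.coe_filter, Finset.mem_univ, true_and, Set.mem_setOf_eq] at hg ⊢
    exact hg
  refine ⟨by rw [hPm, hSm]; omega, fun hI => ?_, fun D₀ hm1 hch hI hPm1 => ?_⟩
  · -- phase 1: the centre position `Dc.i` is old charged and is lost
    have hall : ∀ l, σ l ∈ S.oldCh (φ x) := fun l => by
      have : σ l ∈ (I₀ : Set _) := hrσ ▸ ⟨l, rfl⟩
      rw [hI] at this; exact_mod_cast this
    have hlt : (Finset.univ.filter fun g : Dc.GoodGen => σ g.1 ∈ S.oldCh (φ x)).card <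
        (Finset.univ.filter fun l => σ l ∈ S.oldCh (φ x)).card := by
      rw [← Finset.card_image_of_injective _ (Subtype.val_injective (p := fun j => j ≠ Dc.i ∧ Dc.gen j ∈ Dc.Q))]
      refine Finset.card_lt_card ⟨fun j hj => ?_, fun h => ?_⟩
      · obtain ⟨g, hg, rfl⟩ := Finset.mem_image.mp hj
        simpa using hg
      · have hi : Dc.i ∈ (Finset.univ.filter fun l => σ l ∈ S.oldCh (φ x)) := by simpa using hall Dc.i
        obtain ⟨g, -, hg⟩ := Finset.mem_image.mp (h hi)
        exact g.2.1 hg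
    rw [hPm, hSm]; omega
  · have hPold' : ∀ i', i' ∈ P.oldCh ↔ (∃ m, σ' m ∈ S.oldCh (φ x) ∧ lab' (some (Sum.inl m)) = i') ∨
        (∃ g : Dc.GoodGen, σ g.1 ∈ S.oldCh (φ x) ∧ lab' (some (Sum.inr g)) = i') :=
      roundOver_mem_oldCh_iff S (φ x) P (fun g : Dc.GoodGen => g.1) σ σ' lab' aOf haOfl haOfr hPa hPa0 hPlab
    exact roundOver_phase2 hp S Dc I₀ σ σ' hσ hrσ hrσσ' hdisj P lab' aOf haOf0 haOfl haOfr hPa hxE hmemE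
      hmemT hlabE hlabW hsuppW hsuppX hPold' D₀ hm1 hch hI hPm1

end Summit.ResolutionOfSingularities.ResolutionOfSingularities.Theorems.RadicialJung.CleanModelsSuffice

end
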